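import Summits.AtomisticToContinuum.FouriersLaw.Theses.OddSectorIrreversibility

/-!
# Sketch — crux ideas on `ClosedConeSensitivity` (E3), round 1, ideator 3

Definitions only (no theorems, no sorry). Two lines:

* Card A `symplectic-tilt-thermal-lyapunov`: `TiltInequality` (deterministic, Mathlib-only; FIRST LEMMA),
  `ThermalTangentMGF` (the transfer target C⁺ over tree declarations), `ClosedFlowVariational`
  (fixed-N regularity support), `LineA`.
* Card B `gaussian-ibp-resampled-kick` (repair line): `GaussianIBPProjection` (exact identity; FIRST LEMMA),
  `BoundaryHermiteRegularity`, `ResampledKickCone`, `RepairedWitnessGlue`.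
-/

noncomputable section

open MeasureTheory Filter Set
open scoped BigOperators NNReal

namespace Summit.AtomisticToContinuum.FouriersLaw.Cruxes.ClosedConeSensitivity.Ideator3

open Literature.MathematicalPhysics.KineticTheory.HeatConduction
open Summit.AtomisticToContinuum.FouriersLaw.Theses.OddSectorIrreversibility

/-! ### Card A — the tilted convex (symplectic) tangent energy -/

/-- Local convex tangent energy at site `k`: `δp_k² + κ_k δq_k² + σ_k (δq_{k+1} − δq_k)²`
(the last term absent at the last site). -/
def localTangentEnergy (N : ℕ) (κ σ δq δp : Fin N → ℝ) (k : Fin N) : ℝ :=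
  δp k ^ 2 + κ k * δq k ^ 2 +
    σ k * ∑ j : Fin N, (if j.val = k.val + 1 then (δq j - δq k) ^ 2 else 0)

/-- Combes–Thomas tilted tangent energy `W_θ = Σ_k e^{2θ|k−b|} ε_k`. -/
def tiltedEnergy (N : ℕ) (θ : ℝ) (b : ℕ) (κ σ δq δp : Fin N → ℝ) : ℝ :=
  ∑ k : Fin N, Real.exp (2 * θ * |(k.val : ℝ) - b|) * localTangentEnergy N κ σ δq δp k

/-- Local growth rate `ρ_k = |κ̇_k|/κ_k + |σ̇_k|/σ_k + e^{2θ}(e^{2θ}−1)(√σ_k + √σ_{k−1})`: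
pumping = logarithmic time-derivatives of the stiffnesses (total derivatives in time),
hopping across the tilt = square roots of the stiffnesses. Both scale like `e^{1/4}` at a hot
spot of energy `e` (quartic scaling), not like the flat Lipschitz constant `σ ~ e^{1/2}`. -/
def localRate (N : ℕ) (θ : ℝ) (κ σ dκ dσ : Fin N → ℝ) (k : Fin N) : ℝ :=
  |dκ k| / κ k + |dσ k| / σ k +
    Real.exp (2 * θ) * (Real.exp (2 * θ) - 1) *
      (Real.sqrt (σ k) + ∑ j : Fin N, (if k.val = j.val + 1 then Real.sqrt (σ j) else 0))

/-- Numerator of the averaged rate: `Σ_k e^{2θ|k−b|} ρ_k ε_k` (so that `dW_θ/dt ≤` this). -/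
def tiltRateNum (N : ℕ) (θ : ℝ) (b : ℕ) (κ σ dκ dσ δq δp : Fin N → ℝ) : ℝ :=
  ∑ k : Fin N, Real.exp (2 * θ * |(k.val : ℝ) - b|) *
    (localRate N θ κ σ dκ dσ k * localTangentEnergy N κ σ δq δp k)

/-- **First lemma of Card A (deterministic symplectic Combes–Thomas inequality).** For positive `C¹`
stiffness paths `κ_k(t)` (on-site) and `σ_k(t)` (bonds) and any `C¹` solution `(δq, δp)` of the
linearised lattice system `δq̇ = δp`, `δṗ_k = −κ_kδq_k + σ_k(δq_{k+1}−δq_k) − σ_{k−1}(δq_k−δq_{k−1})`,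
the tilted convex energy obeys Gronwall with ANY continuous majorant `R` of the averaged local rate:
`Num(t) ≤ R(t)·W_θ(t)` on `[0,τ]` ⟹ `W_θ(τ) ≤ W_θ(0)·exp ∫₀^τ R`. (Proof: the `κ` cross terms cancel
exactly — symplectic structure —, the bond cross terms telescope to `Σ 2σ_kδr_kδp_{k+1}(w_k − w_{k+1})`
with `|w_k − w_{k+1}| ≤ (e^{2θ}−1)w_k`, then `2σ|δr||δp| ≤ √σ(σδr² + δp²)`.) Mathlib only. -/
def TiltInequality : Prop :=
  ∀ (N : ℕ) (θ : ℝ) (b : ℕ) (κ σ dκ dσ δq δp : ℝ → Fin N → ℝ) (τ : ℝ), 0 ≤ θ → 0 ≤ τ →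
    (∀ t k, 0 < κ t k) → (∀ t k, 0 < σ t k) →
    (∀ t k, HasDerivAt (fun s => κ s k) (dκ t k) t) →
    (∀ t k, HasDerivAt (fun s => σ s k) (dσ t k) t) →
    (∀ k, Continuous fun t => dκ t k) → (∀ k, Continuous fun t => dσ t k) →
    (∀ t k, HasDerivAt (fun s => δq s k) (δp t k) t) →
    (∀ t k, HasDerivAt (fun s => δp s k)
        (-(κ t k * δq t k)
          + (∑ j : Fin N, (if j.val = k.val + 1 then σ t k * (δq t j - δq t k) else 0))
          - (∑ j : Fin N, (if k.val = j.val + 1 then σ t j * (δq t k - δq t j) else 0))) t) →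
    ∀ R : ℝ → ℝ, Continuous R →
      (∀ t ∈ Set.Icc (0 : ℝ) τ,
          tiltRateNum N θ b (κ t) (σ t) (dκ t) (dσ t) (δq t) (δp t)
            ≤ R t * tiltedEnergy N θ b (κ t) (σ t) (δq t) (δp t)) →
      tiltedEnergy N θ b (κ τ) (σ τ) (δq τ) (δp τ)
        ≤ tiltedEnergy N θ b (κ 0) (σ 0) (δq 0) (δp 0) * Real.exp (∫ t in (0 : ℝ)..τ, R t)

/-! Tree-level objects: the closed flow `Φ_t` is `(pinnedChain ω₂ lam β 0).transitionKernel` (zero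
friction ⇒ zero noise; a Dirac kernel, refuter probe W.lean), its coordinates and their `p_b`-derivatives. -/

section ClosedFlow
variable (ω₂ lam β : ℝ) (N : ℕ) (T : ℝ)

/-- `q_k ∘ Φ_t` as a function of the initial point. -/
def flowQ (t : ℝ) (k : Fin N) (x : PhaseSpace N) : ℝ :=
  ∫ y, y.1 k ∂((pinnedChain ω₂ lam β 0).transitionKernel N T T t.toNNReal x)

/-- `p_k ∘ Φ_t` as a function of the initial point. -/
def flowP (t : ℝ) (k : Fin N) (x : PhaseSpace N) : ℝ :=
  ∫ y, y.2 k ∂((pinnedChain ω₂ lam β 0).transitionKernel N T T t.toNNReal x)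

/-- The tangent vector of a momentum kick at site `b`: `δq_k(t) = ∂_{p_b}(q_k∘Φ_t)`. -/
def tanQ (b : Fin N) (t : ℝ) (x : PhaseSpace N) (k : Fin N) : ℝ :=
  partialP b (flowQ ω₂ lam β N T t k) x

/-- `δp_k(t) = ∂_{p_b}(p_k∘Φ_t)`. -/
def tanP (b : Fin N) (t : ℝ) (x : PhaseSpace N) (k : Fin N) : ℝ :=
  partialP b (flowP ω₂ lam β N T t k) x

/-- On-site stiffness along the orbit: `U''(q_k(t)) = ω₂ + 3 lam q_k(t)²`. -/
def stiffU (t : ℝ) (x : PhaseSpace N) (k : Fin N) : ℝ :=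
  ω₂ + 3 * lam * flowQ ω₂ lam β N T t k x ^ 2

/-- Bond stiffness along the orbit: `V''(r_k(t)) = 1 + 3β (q_{k+1}(t) − q_k(t))²` (and `1` at the last site). -/
def stiffV (t : ℝ) (x : PhaseSpace N) (k : Fin N) : ℝ :=
  1 + 3 * β * (∑ j : Fin N, (if j.val = k.val + 1 then (flowQ ω₂ lam β N T t j x - flowQ ω₂ lam β N T t k x) else 0)) ^ 2

/-- The thermal tilted tangent energy `W_θ(t)(x)` of the kick `e_{p_b}`. -/
def thermalTilted (θ : ℝ) (b : Fin N) (t : ℝ) (x : PhaseSpace N) : ℝ :=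
  tiltedEnergy N θ b.val (stiffU ω₂ lam β N T t x) (stiffV ω₂ lam β N T t x)
    (tanQ ω₂ lam β N T b t x) (tanP ω₂ lam β N T b t x)

/-- Readout weight at bond `i` at time `t`: `V'(r_i)² + (p_i + p_{i+1})² V''(r_i)` along the orbit
(so that `|∂_{p_b}(j_i∘Φ_t)|² ≤ m_i(t)·(ε_i + ε_{i+1})`). -/
def readoutWeight (t : ℝ) (x : PhaseSpace N) (i : Fin N) : ℝ :=
  ∑ j : Fin N, (if j.val = i.val + 1 then
    ((flowQ ω₂ lam β N T t j x - flowQ ω₂ lam β N T t i x)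
        + β * (flowQ ω₂ lam β N T t j x - flowQ ω₂ lam β N T t i x) ^ 3) ^ 2
      + (flowP ω₂ lam β N T t i x + flowP ω₂ lam β N T t j x) ^ 2 * stiffV ω₂ lam β N T t x i
    else 0)

end ClosedFlow

/-- **Transfer target C⁺ of Card A (`ThermalTangentMGF`): the thermal generalized Lyapunov exponent of the
closed pinned chain is finite, N-uniformly, in the tilted convex norm.** For every `θ ∈ (0,1]` there are
`Λ, C` such that for all `N`, contacts `b`, bonds `i`, times `t ≥ 0` and kick offsets `σ ∈ [0,1]`:
`∫ m_i(t)(K_σx)·W_θ(t)(K_σ x) e^{−H(x)/T} dx ≤ C e^{Λt} Z` (`K_σ` = shift of `p_b` by `σ`, which makes the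
`s`-integration of E3 immediate; `W_θ(0) = 1`). With `TiltInequality` this gives E3 with `κ = θ`,
`a = θ/Λ` (up to the readout factor `e^{2θ}`). Its failure mode is EXACTLY E3's: sustained localized
chaotic amplifiers of the scale-free quartic lattice (`L(2) = ∞`). -/
def ThermalTangentMGF : Prop :=
  ∀ ω₂ lam β γ : ℝ, 0 < ω₂ → 0 < lam → 0 < β → 0 < γ → ∀ T : ℝ, 0 < T → ∀ θ : ℝ, 0 < θ → θ ≤ 1 →
    ∃ Λ C : ℝ, ∀ (N : ℕ) (i b : Fin N) (t σ : ℝ), (b.val = 0 ∨ b.val = N - 1) → 0 ≤ t → 0 ≤ σ → σ ≤ 1 →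
      let P := pinnedChain ω₂ lam β γ
      let μT : Measure (PhaseSpace N) :=
        volume.withDensity (fun x : PhaseSpace N => ENNReal.ofReal (Real.exp (-(P.hamiltonian N x) / T)))
      ∫ x, (readoutWeight ω₂ lam β N T t (x.1, Function.update x.2 b (x.2 b + σ)) i *
              thermalTilted ω₂ lam β N T θ b t (x.1, Function.update x.2 b (x.2 b + σ))) ∂μT
        ≤ C * Real.exp (Λ * t) * ∫ x, Real.exp (-(P.hamiltonian N x) / T) ∂volume

/-- Fixed-N regularity support for Card A (`ClosedFlowVariational`): the closed flow coordinates are `C¹`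
in the initial point and their `p_b`-derivatives solve the linearised lattice system along the orbit with
the stiffnesses `stiffU`, `stiffV` (variational equation; Buttà et al. 2007 Thm 2.1 / smooth dependence of
ODE solutions on initial data), with the kick initial datum `δq(0) = 0`, `δp(0) = e_b`. -/
def ClosedFlowVariational : Prop :=
  ∀ ω₂ lam β : ℝ, 0 < ω₂ → 0 < lam → 0 < β → ∀ T : ℝ, 0 < T → ∀ (N : ℕ) (b : Fin N) (x : PhaseSpace N),
    (∀ (t : ℝ) (k : Fin N), 0 ≤ t →
        ContDiff ℝ 1 (flowQ ω₂ lam β N T t k) ∧ ContDiff ℝ 1 (flowP ω₂ lam β N T t k)) ∧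
    (∀ k, tanQ ω₂ lam β N T b 0 x k = 0) ∧ (∀ k, tanP ω₂ lam β N T b 0 x k = if k = b then 1 else 0) ∧
    (∀ (t : ℝ) (k : Fin N), 0 ≤ t →
        HasDerivAt (fun s => tanQ ω₂ lam β N T b s x k) (tanP ω₂ lam β N T b t x k) t) ∧
    (∀ (t : ℝ) (k : Fin N), 0 ≤ t →
        HasDerivAt (fun s => tanP ω₂ lam β N T b s x k)
          (-(stiffU ω₂ lam β N T t x k * tanQ ω₂ lam β N T b t x k)
            + (∑ j : Fin N, (if j.val = k.val + 1 then
                stiffV ω₂ lam β N T t x k * (tanQ ω₂ lam β N T b t x j - tanQ ω₂ lam β N T b t x k) else 0))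
            - (∑ j : Fin N, (if k.val = j.val + 1 then
                stiffV ω₂ lam β N T t x j * (tanQ ω₂ lam β N T b t x k - tanQ ω₂ lam β N T b t x j) else 0))) t)

/-! #### Secant version (finite kicks): the same gauge for the DIFFERENCE of two closed orbits

For two initial points `x, x'` the difference `δ = Φ_t x' − Φ_t x` solves the linearised lattice system
EXACTLY with the secant stiffnesses `κ̄_k = ω₂ + lam (q_k² + q_k q'_k + q'_k²) ≥ ω₂` and
`σ̄_k = 1 + β (r_k² + r_k r'_k + r'_k²) ≥ 1` (`V'(r') − V'(r) = σ̄ (r' − r)`), so `TiltInequality` applies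
verbatim; the cap `|δ| ≤ |Φ_t x| + |Φ_t x'|` is what warm blobs cannot beat. -/

section Secant
variable (ω₂ lam β : ℝ) (N : ℕ) (T : ℝ)

/-- Secant on-site stiffness between the orbits of `x` and `x'`. -/
def secantU (t : ℝ) (x x' : PhaseSpace N) (k : Fin N) : ℝ :=
  ω₂ + lam * (flowQ ω₂ lam β N T t k x ^ 2 + flowQ ω₂ lam β N T t k x * flowQ ω₂ lam β N T t k x'
    + flowQ ω₂ lam β N T t k x' ^ 2)

/-- Bond stretch `r_k = q_{k+1} − q_k` along the orbit (`0` at the last site). -/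
def flowR (t : ℝ) (k : Fin N) (x : PhaseSpace N) : ℝ :=
  ∑ j : Fin N, (if j.val = k.val + 1 then flowQ ω₂ lam β N T t j x - flowQ ω₂ lam β N T t k x else 0)

/-- Secant bond stiffness between the orbits of `x` and `x'`. -/
def secantV (t : ℝ) (x x' : PhaseSpace N) (k : Fin N) : ℝ :=
  1 + β * (flowR ω₂ lam β N T t k x ^ 2 + flowR ω₂ lam β N T t k x * flowR ω₂ lam β N T t k x'
    + flowR ω₂ lam β N T t k x' ^ 2)

/-- Tilted SECANT energy of the difference of the two orbits. -/
def secantTilted (θ : ℝ) (b : Fin N) (t : ℝ) (x x' : PhaseSpace N) : ℝ :=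
  tiltedEnergy N θ b.val (secantU ω₂ lam β N T t x x') (secantV ω₂ lam β N T t x x')
    (fun k => flowQ ω₂ lam β N T t k x' - flowQ ω₂ lam β N T t k x)
    (fun k => flowP ω₂ lam β N T t k x' - flowP ω₂ lam β N T t k x)

/-- Secant readout weight at bond `i` (so that `|j_i(Φ_t x') − j_i(Φ_t x)|² ≤ m̄_i (ε̄_i + ε̄_{i+1})`). -/
def secantReadout (t : ℝ) (x x' : PhaseSpace N) (i : Fin N) : ℝ :=
  (flowR ω₂ lam β N T t i x' + β * flowR ω₂ lam β N T t i x' ^ 3) ^ 2 +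
    (∑ j : Fin N, (if j.val = i.val + 1 then (flowP ω₂ lam β N T t i x + flowP ω₂ lam β N T t j x) ^ 2 else 0))
      * secantV ω₂ lam β N T t x x' i

end Secant

/-- **Surviving transfer target (`SecantTiltMGF`, C⁺ʳ): the tilted secant energy of a THERMALLY RESAMPLED
contact momentum grows at most exponentially in Gibbs mean, N-uniformly.** Warm blobs (the mechanism that
makes the tangent version `ThermalTangentMGF` false as `∃Λ ∀t`) are neutralised by the cap; warm CORRIDORS
only renormalise the speed (`Λ̄(θ) = 2θ v + O(θ²)` by their large-deviation cost). With `TiltInequality`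
(secant form) it yields card B's `ResampledKickCone` with EXPONENTIAL decay and `a = 2θ/Λ̄(θ) → 1/v_eff`. -/
def SecantTiltMGF : Prop :=
  ∀ ω₂ lam β γ : ℝ, 0 < ω₂ → 0 < lam → 0 < β → 0 < γ → ∀ T : ℝ≥0, 0 < (T : ℝ) → ∀ θ : ℝ, 0 < θ → θ ≤ 1 →
    ∃ Λ C : ℝ, ∀ (N : ℕ) (i b : Fin N) (t : ℝ), (b.val = 0 ∨ b.val = N - 1) → 0 ≤ t →
      let P := pinnedChain ω₂ lam β γ
      let μT : Measure (PhaseSpace N) :=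
        volume.withDensity (fun x : PhaseSpace N => ENNReal.ofReal (Real.exp (-(P.hamiltonian N x) / T)))
      ∫ x, (∫ p', secantReadout ω₂ lam β N T t x (x.1, Function.update x.2 b p') i *
                secantTilted ω₂ lam β N T θ b t x (x.1, Function.update x.2 b p')
              ∂(ProbabilityTheory.gaussianReal 0 T)) ∂μT
        ≤ C * Real.exp (Λ * t) * ∫ x, Real.exp (-(P.hamiltonian N x) / T) ∂volume

/-- Shape of line A (elaboration check only; the crux-plan seat makes `TiltInequality`, the readout
inequality, `ClosedFlowVariational` and `ThermalTangentMGF` the stubs of `ClosedConeSensitivity_of`). -/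
def LineA : Prop :=
  TiltInequality → ClosedFlowVariational → ThermalTangentMGF → ClosedConeSensitivity

/-! ### Card B — Gaussian integration by parts in the thermostatted momentum + resampling projection -/

section GaussianIBP
variable {N : ℕ}

/-- The Ornstein–Uhlenbeck (bath) operator at site `b`: `𝒩_b f = −T ∂²_{p_b} f + p_b ∂_{p_b} f`
(so that the Langevin bath term is `S_b = −γ 𝒩_b`). -/
def bathOp (T : ℝ) (b : Fin N) (f : PhaseSpace N → ℝ) (x : PhaseSpace N) : ℝ :=
  -(T * partialP b (partialP b f) x) + x.2 b * partialP b f x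

/-- Resampling projection `Π_b g (x) = ∫ g(q, p[b ↦ p']) dN(0,T)(p')`. -/
def resample (T : ℝ≥0) (b : Fin N) (g : PhaseSpace N → ℝ) (x : PhaseSpace N) : ℝ :=
  ∫ p', g (x.1, Function.update x.2 b p') ∂(ProbabilityTheory.gaussianReal 0 T)

/-- Mean-square resampled-kick difference `½ ∫ (g(q,p[b↦p']) − g(q,p))² dN(0,T)(p')`. -/
def resampleVar (T : ℝ≥0) (b : Fin N) (g : PhaseSpace N → ℝ) (x : PhaseSpace N) : ℝ :=
  (1 / 2) * ∫ p', (g (x.1, Function.update x.2 b p') - g x) ^ 2 ∂(ProbabilityTheory.gaussianReal 0 T)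

end GaussianIBP

/-- **First lemma of Card B (`GaussianIBPProjection`, exact, fixed N).** Under the Gibbs weight
`e^{−H_N/T}` of the pinned chain (Gaussian `N(0,T)` in each momentum, independent of the rest), for
`f ∈ C²`, `g ∈ C¹` with the displayed integrability:
(1) `T ∫ ∂_{p_b}f ∂_{p_b}g e^{−H/T} = ∫ (𝒩_b f)(g − Π_b g) e^{−H/T}` — the derivative of `g` is traded
for a FINITE thermal resampling of `p_b`, the second derivative landing on `f`;
(2) `∫ (g − Π_b g)² e^{−H/T} = ∫ resampleVar g · e^{−H/T}`.
(1-D Gaussian integration by parts in `p_b` + `⟨𝒩_b f, h⟩ = 0` for `h` not depending on `p_b`.) -/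
def GaussianIBPProjection : Prop :=
  ∀ ω₂ lam β γ : ℝ, 0 < ω₂ → 0 < lam → 0 < β → 0 < γ → ∀ T : ℝ≥0, 0 < (T : ℝ) →
    ∀ (N : ℕ) (b : Fin N) (f g : PhaseSpace N → ℝ),
      let P := pinnedChain ω₂ lam β γ
      let μT : Measure (PhaseSpace N) :=
        volume.withDensity (fun x : PhaseSpace N => ENNReal.ofReal (Real.exp (-(P.hamiltonian N x) / T)))
      ContDiff ℝ 2 f → ContDiff ℝ 1 g →
      Integrable (fun x => partialP b f x * partialP b g x) μT →
      Integrable (fun x => bathOp T b f x * g x) μT →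
      Integrable (fun x => bathOp T b f x * resample T b g x) μT →
      Integrable (fun x => (g x) ^ 2) μT →
        (T : ℝ) * ∫ x, partialP b f x * partialP b g x ∂μT
            = ∫ x, bathOp T b f x * (g x - resample T b g x) ∂μT ∧
        ∫ x, (g x - resample T b g x) ^ 2 ∂μT = ∫ x, resampleVar T b g x ∂μT

/-- **New support item proposed by Card B (`BoundaryHermiteRegularity`).** For the open equilibrium
corrector `u` (characterised exactly as in `ConeScaleCorrector`/`CorrectorTheory`: a.e. limit of the
finite-horizon Kubo correctors) and its even part `u⁺ = (u + u∘Θ)/2`, the bath operator at each contact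
costs no more than the tap energy: `∫ (𝒩_b u⁺)² e^{−H/T} ≤ C (∫ u·J e^{−H/T} + Z)` uniformly in `N`
(recall `γT Σ_b ∫(∂_{p_b}u)² = ∫ u J`, CorrectorTheory (6)). Heuristic: the noise acts EXACTLY on `p_b`,
so `u` has no fine structure in `p_b` (Bismut–Elworthy–Li / Malliavin smoothing in the noise direction is
immediate); the honest risk is the `∂_{q_b}`/`∂_{p_{b+1}}` directions entering through `[𝒩_b, A]`. -/
def BoundaryHermiteRegularity : Prop :=
  ∀ ω₂ lam β γ : ℝ, 0 < ω₂ → 0 < lam → 0 < β → 0 < γ → ∀ T : ℝ, 0 < T → ∃ C : ℝ,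
    ∀ (N : ℕ) (b : Fin N) (u : PhaseSpace N → ℝ), (b.val = 0 ∨ b.val = N - 1) →
      let P := pinnedChain ω₂ lam β γ
      let μT : Measure (PhaseSpace N) :=
        volume.withDensity (fun x : PhaseSpace N => ENNReal.ofReal (Real.exp (-(P.hamiltonian N x) / T)))
      let J : PhaseSpace N → ℝ := fun z => ∑ i : Fin N, P.bondCurrent N i z
      let ue : PhaseSpace N → ℝ := fun x => (u x + u (x.1, -x.2)) / 2
      ContDiff ℝ 2 u →
      (∀ᵐ x ∂μT, Tendsto (fun τ : ℝ => ∫ t in Set.Ioc (0 : ℝ) τ,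
          (∫ y, J y ∂(P.transitionKernel N T T t.toNNReal x))) atTop (nhds (u x))) →
        ∫ x, (bathOp T b ue x) ^ 2 ∂μT ≤ C * ((∫ x, u x * J x ∂μT) + ∫ x, Real.exp (-(P.hamiltonian N x) / T) ∂volume)

/-- **Repaired cone of Card B (`ResampledKickCone`): mean-square locality of the closed flow under a
THERMAL RESAMPLING of the contact momentum** (finite kicks `p_b ↦ p' ~ N(0,T)`, capped differences,
no `s → 0`): `∫ resampleVar_T(j_i∘Φ_t) e^{−H/T} ≤ C (1 + (d − t/a))^{-m} Z` for `t ≤ a d`, with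
polynomial decay `m` (any `m > 3` suffices for the repaired glue; exponential expected). Immune to
source amplifiers (bounded gain); its honest enemy is ballistic transport of energy lumps with
`d`-independent probability (pinning is the bet). -/
def ResampledKickCone : Prop :=
  ∀ ω₂ lam β γ : ℝ, 0 < ω₂ → 0 < lam → 0 < β → 0 < γ → ∀ T : ℝ≥0, 0 < (T : ℝ) → ∀ m : ℝ, 0 < m →
    ∃ a C : ℝ, 0 < a ∧ ∀ (N : ℕ) (i b : Fin N) (t : ℝ), (b.val = 0 ∨ b.val = N - 1) → 0 ≤ t →
      let P := pinnedChain ω₂ lam β γ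
      let P₀ := pinnedChain ω₂ lam β 0
      let μT : Measure (PhaseSpace N) :=
        volume.withDensity (fun x : PhaseSpace N => ENNReal.ofReal (Real.exp (-(P.hamiltonian N x) / T)))
      let d : ℕ := (if b.val = 0 then i.val else N - 2 - i.val)
      let jt : PhaseSpace N → ℝ := fun x => ∫ y, P.bondCurrent N i y ∂(P₀.transitionKernel N T T t.toNNReal x)
      t ≤ a * (d : ℝ) →
        ∫ x, resampleVar T b jt x ∂μT ≤ C * (1 + ((d : ℝ) - t / a)) ^ (-m) * ∫ x, Real.exp (-(P.hamiltonian N x) / T) ∂volume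

/-- Site energy of the pinned chain (bond energies split evenly): `p_k²/2 + U(q_k) + ½V(r_k) + ½V(r_{k−1})`. -/
def siteEnergy (ω₂ lam β : ℝ) (N : ℕ) (x : PhaseSpace N) (k : Fin N) : ℝ :=
  x.2 k ^ 2 / 2 + (ω₂ * x.1 k ^ 2 / 2 + lam * x.1 k ^ 4 / 4) +
    (1 / 2) * ∑ j : Fin N, (if j.val = k.val + 1 ∨ k.val = j.val + 1 then
      ((x.1 j - x.1 k) ^ 2 / 2 + β * (x.1 j - x.1 k) ^ 4 / 4) else 0)

/-- Energy of the 3-site window around `k`. -/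
def windowEnergy (ω₂ lam β : ℝ) (N : ℕ) (x : PhaseSpace N) (k : Fin N) : ℝ :=
  ∑ j : Fin N, (if j.val + 1 = k.val ∨ j.val = k.val ∨ j.val = k.val + 1 then siteEnergy ω₂ lam β N x j else 0)

/-- **Shared named input of both lines (`HotSpotPersistenceTail`)** — the one dynamical fact every
absolute-value (Gronwall / path-sum) method on this crux needs and cannot currently supply: a 3-site
window of the CLOSED chain that is hot at level `E` stays hot (in time average) for `τ` units of time
only with probability `≤ C e^{−E/T} (1 + E^{1/4}τ)^{−4}` — persistence measured in the hot spot's own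
periods `E^{−1/4}`, N-uniform because local. FALSE if thermal elliptic breathers have a non-vanishing
formation probability and super-polynomial life (then only a tool that certifies "elliptic hot spots are
bounded-gain transducers" can prove E3/E3ʳ); recorded as the candidate barrier in NOTES.md. -/
def HotSpotPersistenceTail : Prop :=
  ∀ ω₂ lam β γ : ℝ, 0 < ω₂ → 0 < lam → 0 < β → 0 < γ → ∀ T : ℝ, 0 < T → ∃ C E₀ : ℝ,
    ∀ (N : ℕ) (k : Fin N) (E τ : ℝ), E₀ ≤ E → 0 < τ →
      let P := pinnedChain ω₂ lam β γ
      let P₀ := pinnedChain ω₂ lam β 0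
      let μT : Measure (PhaseSpace N) :=
        volume.withDensity (fun x : PhaseSpace N => ENNReal.ofReal (Real.exp (-(P.hamiltonian N x) / T)))
      let wE : ℝ → PhaseSpace N → ℝ := fun s x =>
        ∫ y, windowEnergy ω₂ lam β N y k ∂(P₀.transitionKernel N T T s.toNNReal x)
      μT {x | τ * E ≤ ∫ s in Set.Ioc (0 : ℝ) τ, wE s x}
        ≤ ENNReal.ofReal (C * Real.exp (-E / T) * (1 + E ^ (1 / 4 : ℝ) * τ) ^ (-(4 : ℝ)) *
            ∫ x, Real.exp (-(P.hamiltonian N x) / T) ∂volume)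

/-- Shape of the repaired glue (Card B, addressed to the tenure planner): the leak of the transport-witness
pairing is bounded through `GaussianIBPProjection` by `γ Σ_b ‖𝒩_b u⁺‖·‖(I − Π_b)(j_i∘Φ_t)‖`, i.e. by
`BoundaryHermiteRegularity × ResampledKickCone`, in place of the tap identity × `ClosedConeSensitivity`. -/
def RepairedWitnessGlue : Prop :=
  GaussianIBPProjection → CorrectorTheory → BoundaryHermiteRegularity → ResampledKickCone →
    ConeScaleCorrector → SubBallisticWindow → GibbsSteadyState → NessUnique → BoundedResponse

/-- Shape of the repaired line A → B: the secant gauge is the ENGINE of card B's cone half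
(exponential decay, explicit slope), the Gaussian IBP its corrector half. -/
def LineAR : Prop :=
  TiltInequality → SecantTiltMGF → ResampledKickCone

end Summit.AtomisticToContinuum.FouriersLaw.Cruxes.ClosedConeSensitivity.Ideator3

end
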